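import Mathlib
import Literature.MathematicalPhysics.QuantumFieldTheory.Balaban1983to89.B13ScaleTransfer

/-!
# `Balaban1983to89.B13Ineq232` — a kernel-checked substitute for the geometric inequality (2.32) of
T. Bałaban, *Renormalization group approach to lattice gauge field theories. II. Cluster expansions*,
Commun. Math. Phys. **116**, 1–22 (1988), doi:10.1007/bf01239022 [Balaban1988RG2Cluster] (cell paper B13; PDF held
`paper:balaban1988-cmp116-rg-ii-cluster`, journal page = PDF page), p. 18.

CITATION HEADER (lean-in-tree rule 2026-08-18).  The passage under audit, p. 18 [PDF 18], verbatim from the page render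
(`1988-cmp116-rg-II-cluster-p018-x2.png`): *"In general the set Z₀ is a union of connected components. Let us denote
one of the components by Z₀. It contains Y₀ = ∪_i Y_i. By a simple geometric argument we have*
  `Σ_i d_k(Y_i) + 4M⁻⁴|Z₀∖Y₀| ≧ d_k(Z₀).`   (2.32)
*Assuming (1/20)γ₂ε₁²/g_k² ≧ (1/20)γ₂ε₁²/γ² ≧ 4κ, …"*.  Here (p. 18 top) *"(2.26) factorizes into products over Y∈𝐃_i.
For simplicity let us denote by Y₀ one of the components"*, so the `Y_i` are the connected components of the union
`Y₀` of the domains of the family 𝐃, `Z₀` is a connected localization domain from 𝐃_k containing them, and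
`M⁻⁴|Z₀∖Y₀|` is the number of cubes of `Z₀` outside `Y₀`; `d_k` is the tree length of [Balaban1987RG1] p. 257
(*"A length of a shortest graph in this class, divided by M, is the linear size of X, and is denoted by d_j(X)"*).
The paper prints NO proof of (2.32).  The cell's P13 sub-cell found (2.32) FALSE with the constant 4 (cell GAPS.md
G-B13-08: eight straight arms around one extra cube) and repaired it by hand with the constant 18
(`B13.Consts.R16repaired`).  (2.32) is used twice: p. 18 (above) and p. 20 *"Using the inequality (2.32), properly
adapted to the new situation"*.

WHAT IS REPRODUCED (unit `b2b-balaban-pv11`, surge node prover #11; companion of `…B13ScaleTransfer`, whose ℤ^d index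
model of the cubes of π_k — `Pt`, `Adj` (common wall), `FaceConnected` (B12's "connected family"), `Linked` — and whose
quoted leaf `AdjoinLeaf` are reused).  A sorry-free SUBSTITUTE for (2.32) with explicit constants,
  `d_k(Z₀) ≤ Σ_i d_k(Y_i) + (1 + 2d(1 + c_J))·M⁻⁴|Z₀∖Y₀|`   (`ineq232_subst`; d = 4, c_J = 1: constant 17 ≤ 18),
KERNEL-CHECKED modulo two PUBLISHED, PROVED lemmas on the tree length entered as verbatim-quoted leaf `Prop`s
(hypotheses, never asserted):
 * `AdjoinLeaf` (from `…B13ScaleTransfer`) = J. Dimock, *The renormalization group according to Balaban. I. Small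
   fields*, Rev. Math. Phys. **25** (2013) 1330010 = arXiv:1108.1335 [Dimock2013], §4 Lemma 20: *"For X, Y ∈ 𝒟_k and
   X ⊂ Y: M d_M(Y) ≤ M|Y − X|_M + M d_M(X)"*;
 * `UnionLeaf c_J` = [Dimock2013], appendix "cluster expansion", proof of Theorem 27, verbatim: *"Next we claim that
   if ∪_{i=1}^n X_i = Y as above* [*"we require that the {X_i} cannot be divided into two disjoint sets"*]*, then
   M d_M(Y) ≤ Σ_{i=1}^n M d_M(X_i) + M(n−1).  Indeed let τ_i be a minimal tree on X_i of length M d_M(X_i).  Also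
   consider the connected graph whose edges are pairs {X_i, X_j} such that X_i ∩ X_j ≠ ∅. Take a tree which is a
   subgraph with (n−1) edges. Each pair {X_i, X_j} in this tree will have a block □ in common. For each pair add a
   line in □ joining the point in τ_i to the point in τ_j. This line has length at most M. The tree graph consisting
   of the τ_i and the (n−1) extra lines now joins all the blocks in Y and has length less than Σ M d_M(X_i) + M(n−1).
   The minimal tree must have shorter length which is the claim."* — used here only for n = 2, with the joining
   constant displayed as a parameter `c_J` ("length at most M" is the sup-metric statement; for the Euclidean metric
   two points of one cube are at distance ≤ √d·M, for ℓ¹ at distance ≤ d·M; [Balaban1987RG1] does not name the metric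
   of d_j — cell DIVERGENCE D-T2).
The KERNEL content is the combinatorics the paper calls "a simple geometric argument": (i) `growth` — starting from
one component, absorb either an adjacent extra cube (cost 1, `AdjoinLeaf`) or an adjacent component (cost 1 + c_J:
adjoin the touching cube to the component, then `UnionLeaf`), which gives
`d_k(Z₀) ≤ Σ_i d_k(Y_i) + M⁻⁴|Z₀∖Y₀| + (1 + c_J)(n − 1)` (`tl_le_sum_add`), and (ii) the counting `n − 1 ≤ 2d·M⁻⁴|Z₀∖Y₀|`
(`card_parts_le`): when there are at least two components every component has a common wall with an extra cube
(components are pairwise disjoint and have no common walls), and a cube has 2d walls.  Part 4 records the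
exponential form in which (2.32) is consumed in (2.33) p. 19 (`case_nonempty_233`, the Y₀ ≠ ∅ case; Y₀ = ∅ is
`B13.case_empty_233`) and checks that the repaired smallness clause `B13.Consts.R16repaired` (constant 18) of the b13
sub-cell covers the kernel constant 17 (sup-metric).  Part 5 (revision v2, append-only) does the same for the
second use, p. 20 *"Using the inequality (2.32), properly adapted to the new situation"* after (2.37): there the
Z′_i *"denote connected components of Z′₀"*, so the adapted inequality is (2.32) one scale up (the same `CompData`
statement) and only the exponential bookkeeping (`adapted_p20`) and the clause *"½(κ₁ − 1) ≧ 2Lκ"* (`R20`,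
`R20With`: 17ℓκ ≤ ½(κ₁ − 1) for a transfer factor ℓ) are added.
NOTHING of the series is asserted: the printed (2.32) is typed for the record only (`Ineq232Printed`, used nowhere);
the tree length is NOT formalised (cell DIVERGENCE F5) — `tl` is an arbitrary real function on finite index sets and
the two leaves are its only properties used.  `B13.lean` (units r2/b13), `B13FamilySum.lean` (pv18) and
`B13ScaleTransfer.lean` are untouched.  Staged byte-identically in the cell package
`run/shared/lean/pub/pub-balaban/lean/BalabanYm4/Literature/…/B13Ineq232.lean`.
-/

noncomputable section

namespace Literature.MathematicalPhysics.QuantumFieldTheory.Balaban1983to89.B13Ineq232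

open Literature.MathematicalPhysics.QuantumFieldTheory.Balaban1983to89.B13ScaleTransfer

variable {d : ℕ}

/-! ## Part 1. More combinatorics of connected families of cubes (ℤ^d index model of `…B13ScaleTransfer`) -/

/-- Every cube is chain-connected to itself. [folklore] -/
theorem linked_refl (S : Finset (Pt d)) (x : Pt d) : Linked S x x :=
  Relation.ReflTransGen.refl

/-- Two cubes with a common wall form a connected family. [folklore] -/
theorem faceConnected_pair {x y : Pt d} (h : Adj x y) : FaceConnected ({x, y} : Finset (Pt d)) := by
  have hx : x ∈ ({x, y} : Finset (Pt d)) := by simp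
  have hy : y ∈ ({x, y} : Finset (Pt d)) := by simp
  have hxy : Linked ({x, y} : Finset (Pt d)) x y := linked_of_stepIn ⟨hx, hy, h⟩
  intro a ha b hb
  simp only [Finset.mem_insert, Finset.mem_singleton] at ha hb
  rcases ha with ha | ha <;> rcases hb with hb | hb <;> rw [ha, hb]
  · exact linked_refl _ _
  · exact hxy
  · exact hxy.symm
  · exact linked_refl _ _

/-- The union of two connected families with a cube in common is a connected family. [folklore] -/
theorem faceConnected_union {S T : Finset (Pt d)} (hS : FaceConnected S) (hT : FaceConnected T)
    (h : (S ∩ T).Nonempty) : FaceConnected (S ∪ T) := by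
  obtain ⟨z, hz⟩ := h
  rw [Finset.mem_inter] at hz
  intro x hx y hy
  rw [Finset.mem_union] at hx hy
  have hxz : Linked (S ∪ T) x z := by
    rcases hx with hx | hx
    · exact (hS x hx z hz.1).mono Finset.subset_union_left
    · exact (hT x hx z hz.2).mono Finset.subset_union_right
  have hzy : Linked (S ∪ T) z y := by
    rcases hy with hy | hy
    · exact (hS z hz.1 y hy).mono Finset.subset_union_left
    · exact (hT z hz.2 y hy).mono Finset.subset_union_right
  exact hxz.trans hzy

/-- Adjoining to a connected family a cube having a common wall with one of its cubes keeps it connected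
([Balaban1987RG1] p. 257 definition; the elementary step of every "adding cubes" argument, e.g. [Dimock2013] §4
Lemma 20). [folklore] -/
theorem faceConnected_insert {S : Finset (Pt d)} (hS : FaceConnected S) {x y : Pt d} (hx : x ∈ S)
    (hxy : Adj x y) : FaceConnected (insert y S) := by
  have hu : insert y S = S ∪ {x, y} := by
    ext z
    simp only [Finset.mem_insert, Finset.mem_union, Finset.mem_singleton]
    constructor
    · rintro (h | h)
      · exact Or.inr (Or.inr h)
      · exact Or.inl h
    · rintro (h | h | h)
      · exact Or.inr h
      · exact Or.inr (by rw [h]; exact hx)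
      · exact Or.inl h
  rw [hu]
  exact faceConnected_union hS (faceConnected_pair hxy) ⟨x, Finset.mem_inter.mpr ⟨hx, by simp⟩⟩

/-- First exit of a chain: if a chain of cubes inside `Z` starts in `S` and ends outside `S`, some cube of `S` has a
common wall with a cube of `Z` outside `S`. [folklore] -/
theorem exists_adj_exit {Z S : Finset (Pt d)} {x y : Pt d} (h : Linked Z x y) (hx : x ∈ S) (hy : y ∉ S) :
    ∃ a b : Pt d, a ∈ S ∧ b ∉ S ∧ b ∈ Z ∧ Adj a b := by
  unfold Linked at h
  induction h with
  | refl => exact absurd hx hy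
  | @tail b c _ hbc ih =>
    by_cases hb : b ∈ S
    · exact ⟨b, c, hb, hy, hbc.2.1, hbc.2.2⟩
    · exact ih hb

/-- The 2d cubes having a common wall with the cube `b`, coded by (direction, sign): b ± e_i. [folklore] -/
def nbr (b : Pt d) (p : Fin d × Bool) : Pt d :=
  Function.update b p.1 (b p.1 + (if p.2 then 1 else -1))

/-- A cube with a common wall with `b` is one of the 2d coded neighbours of `b`. [folklore] -/
theorem exists_code_of_adj {a b : Pt d} (h : Adj a b) : ∃ p : Fin d × Bool, a = nbr b p := by
  obtain ⟨i, h | h⟩ := h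
  · refine ⟨(i, false), ?_⟩
    subst h
    simp [nbr, Function.update_idem]
  · exact ⟨(i, true), by simpa [nbr] using h⟩

/-! ## Part 2. The datum of (2.32) and the two leaves -/

/-- The geometric datum of (2.32) on the ℤ^d index model: a connected family `Z₀` (*"one of the components"*) and the
finite set `parts` of the components `Y_i` of `Y₀ = ∪_i Y_i ⊂ Z₀` — each a non-empty connected family inside `Z₀`,
pairwise disjoint and pairwise WITHOUT common walls (distinct connected components of a family of cubes).
[cite: Balaban1988RG2Cluster, (2.32) p.18] -/
structure CompData (d : ℕ) where
  /-- the connected component Z₀ -/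
  Z₀ : Finset (Pt d)
  /-- the components Y_i of Y₀ -/
  parts : Finset (Finset (Pt d))
  hZ : FaceConnected Z₀
  sub : ∀ P ∈ parts, P ⊆ Z₀
  ne : ∀ P ∈ parts, P.Nonempty
  conn : ∀ P ∈ parts, FaceConnected P
  disj : ∀ P ∈ parts, ∀ Q ∈ parts, P ≠ Q → Disjoint P Q
  sep : ∀ P ∈ parts, ∀ Q ∈ parts, P ≠ Q → ∀ x ∈ P, ∀ y ∈ Q, ¬ Adj x y

namespace CompData

variable (D : CompData d)

/-- `Y₀ = ∪_i Y_i`. [cite: Balaban1988RG2Cluster, (2.32) p.18] -/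
def Y₀ : Finset (Pt d) := D.parts.biUnion id

/-- The extra cubes `Z₀ ∖ Y₀` (their number is the printed `M⁻⁴|Z₀∖Y₀|`). [cite: Balaban1988RG2Cluster, (2.32) p.18] -/
def W : Finset (Pt d) := D.Z₀ \ D.Y₀

/-- A stage of the growth argument: the union of a sub-family of components and a subset of extra cubes. [folklore] -/
def stage (parts' : Finset (Finset (Pt d))) (W' : Finset (Pt d)) : Finset (Pt d) := parts'.biUnion id ∪ W'

/-- Membership in `Y₀ = ∪_i Y_i`. [folklore] -/
theorem mem_Y₀ {x : Pt d} : x ∈ D.Y₀ ↔ ∃ P ∈ D.parts, x ∈ P := by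
  simp [Y₀]

/-- `Y₀ ⊂ Z₀` (*"It contains Y₀ = ∪_i Y_i"*). [folklore] -/
theorem Y₀_subset : D.Y₀ ⊆ D.Z₀ := by
  intro x hx
  obtain ⟨P, hP, hxP⟩ := D.mem_Y₀.mp hx
  exact D.sub P hP hxP

/-- `Z₀ ∖ Y₀ ⊂ Z₀`. [folklore] -/
theorem W_subset : D.W ⊆ D.Z₀ := Finset.sdiff_subset

/-- Membership in `Z₀ ∖ Y₀`. [folklore] -/
theorem mem_W {x : Pt d} : x ∈ D.W ↔ x ∈ D.Z₀ ∧ x ∉ D.Y₀ := Finset.mem_sdiff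

/-- Every stage lies in `Z₀`. [folklore] -/
theorem stage_subset {parts' : Finset (Finset (Pt d))} {W' : Finset (Pt d)} (hp : parts' ⊆ D.parts)
    (hW : W' ⊆ D.W) : stage parts' W' ⊆ D.Z₀ := by
  intro x hx
  rcases Finset.mem_union.mp hx with hx | hx
  · obtain ⟨P, hP, hxP⟩ := Finset.mem_biUnion.mp hx
    exact D.sub P (hp hP) hxP
  · exact D.W_subset (hW hx)

/-- The part of a cube of `Y₀` is unique (components are disjoint). [folklore] -/
theorem part_eq {P Q : Finset (Pt d)} (hP : P ∈ D.parts) (hQ : Q ∈ D.parts) {x : Pt d} (hxP : x ∈ P)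
    (hxQ : x ∈ Q) : P = Q := by
  by_contra hne
  exact Finset.disjoint_left.mp (D.disj P hP Q hQ hne) hxP hxQ

end CompData

/-- LEAF (published, proved) — [Dimock2013], appendix "cluster expansion", proof of Theorem 27, verbatim: *"Next we
claim that if ∪_{i=1}^n X_i = Y as above* [the X_i *"cannot be divided into two disjoint sets"*]*, then M d_M(Y) ≤
Σ_{i=1}^n M d_M(X_i) + M(n−1). … For each pair add a line in □ joining the point in τ_i to the point in τ_j. This
line has length at most M. … The minimal tree must have shorter length which is the claim."*  Used for n = 2 only
(two connected families with a cube in common), with the joining constant displayed as `cJ` (= 1 for the sup-metric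
as printed; √d Euclidean, d for ℓ¹). HYPOTHESIS here. [cite: Dimock2013, proof of Thm. 27 (tree-length inequality for overlapping families)] -/
def UnionLeaf (d : ℕ) (cJ : ℝ) (tl : Finset (Pt d) → ℝ) : Prop :=
  ∀ X₁ X₂ : Finset (Pt d), X₁.Nonempty → X₂.Nonempty → FaceConnected X₁ → FaceConnected X₂ →
    (X₁ ∩ X₂).Nonempty → tl (X₁ ∪ X₂) ≤ tl X₁ + tl X₂ + cJ

/-- (2.32) exactly as printed (p. 18), on the datum `D`, for the record: *"Σ_i d_k(Y_i) + 4M⁻⁴|Z₀∖Y₀| ≧ d_k(Z₀)"*.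
FALSE with the constant 4 for the tree length of [Balaban1987RG1] (cell GAPS.md G-B13-08); NOT used below. [cite: Balaban1988RG2Cluster, (2.32) p.18] -/
def Ineq232Printed (D : CompData d) (tl : Finset (Pt d) → ℝ) : Prop :=
  tl D.Z₀ ≤ ∑ P ∈ D.parts, tl P + 4 * (D.W.card : ℝ)

/-! ## Part 3. The growth argument -/

namespace CompData

variable (D : CompData d)

/-- GROWTH.  For every `k` there is a connected stage made of a non-empty sub-family of components and some extra
cubes which either is all of `Z₀` or has at least `k` constituents, and whose tree length is at most
`Σ (tree lengths of its components) + (number of its extra cubes) + (1 + cJ)·(number of its components − 1)`.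
Induction on `k`: a stage short of `Z₀` has a cube with a common wall to a cube of `Z₀` outside it (`exists_adj_exit`);
an extra cube is adjoined at cost 1 (`AdjoinLeaf`), a cube of a new component `Q` brings in `Q` at cost `1 + cJ`
(adjoin the touching stage cube to `Q`, then `UnionLeaf`). [folklore] -/
theorem growth (hne : D.parts.Nonempty) {cJ : ℝ} {tl : Finset (Pt d) → ℝ} (hA : AdjoinLeaf d tl)
    (hU : UnionLeaf d cJ tl) (k : ℕ) :
    ∃ parts' : Finset (Finset (Pt d)), ∃ W' : Finset (Pt d), parts' ⊆ D.parts ∧ W' ⊆ D.W ∧ parts'.Nonempty ∧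
      FaceConnected (stage parts' W') ∧ (stage parts' W' = D.Z₀ ∨ k ≤ parts'.card + W'.card) ∧
      tl (stage parts' W') ≤ ∑ P ∈ parts', tl P + (W'.card : ℝ) + (1 + cJ) * ((parts'.card : ℝ) - 1) := by
  classical
  induction k with
  | zero =>
    obtain ⟨P₀, hP₀⟩ := hne
    refine ⟨{P₀}, ∅, Finset.singleton_subset_iff.mpr hP₀, Finset.empty_subset _, Finset.singleton_nonempty _,
      ?_, Or.inr (Nat.zero_le _), ?_⟩
    · have hs : stage {P₀} ∅ = P₀ := by simp [stage]
      rw [hs]; exact D.conn P₀ hP₀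
    · have hs : stage {P₀} ∅ = P₀ := by simp [stage]
      rw [hs]; simp
  | succ k ih =>
    obtain ⟨parts', W', hp, hW, hne', hconn, hor, hbd⟩ := ih
    by_cases hS : stage parts' W' = D.Z₀
    · exact ⟨parts', W', hp, hW, hne', hconn, Or.inl hS, hbd⟩
    -- the stage is a proper part of Z₀
    have hk : k ≤ parts'.card + W'.card := hor.resolve_left hS
    have hsub : stage parts' W' ⊆ D.Z₀ := D.stage_subset hp hW
    obtain ⟨y, hyZ, hyS⟩ : ∃ y ∈ D.Z₀, y ∉ stage parts' W' := by
      by_contra hcon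
      push Not at hcon
      exact hS (Finset.Subset.antisymm hsub hcon)
    obtain ⟨P₁, hP₁⟩ := hne'
    obtain ⟨x₀, hx₀⟩ := D.ne P₁ (hp hP₁)
    have hx₀S : x₀ ∈ stage parts' W' :=
      Finset.mem_union.mpr (Or.inl (Finset.mem_biUnion.mpr ⟨P₁, hP₁, hx₀⟩))
    obtain ⟨a, b, ha, hb, hbZ, hab⟩ := exists_adj_exit (D.hZ x₀ (hsub hx₀S) y hyZ) hx₀S hyS
    have hSne : (stage parts' W').Nonempty := ⟨a, ha⟩
    by_cases hbY : b ∈ D.Y₀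
    · -- `b` lies in a component `Q`, necessarily a new one: absorb `Q`
      obtain ⟨Q, hQ, hbQ⟩ := D.mem_Y₀.mp hbY
      have hQnew : Q ∉ parts' := by
        intro hQ'
        exact hb (Finset.mem_union.mpr (Or.inl (Finset.mem_biUnion.mpr ⟨Q, hQ', hbQ⟩)))
      have haQ : a ∉ Q := by
        intro haQ
        rcases Finset.mem_union.mp ha with ha' | ha'
        · obtain ⟨P, hP, haP⟩ := Finset.mem_biUnion.mp ha'
          exact hQnew (D.part_eq (hp hP) hQ haP haQ ▸ hP)
        · exact ((D.mem_W.mp (hW ha')).2) (D.mem_Y₀.mpr ⟨Q, hQ, haQ⟩)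
      have hQa : FaceConnected (insert a Q) := faceConnected_insert (D.conn Q hQ) hbQ hab.symm
      have htQa : tl (insert a Q) ≤ 1 + tl Q := by
        have h1 := hA Q (insert a Q) (D.ne Q hQ) (Finset.subset_insert a Q) (D.conn Q hQ) hQa
        have hc : ((insert a Q \ Q).card : ℝ) = 1 := by
          have : insert a Q \ Q = {a} := by
            ext z
            simp only [Finset.mem_sdiff, Finset.mem_insert, Finset.mem_singleton]
            constructor
            · rintro ⟨h | h, h'⟩
              · exact h
              · exact absurd h h'
            · rintro h
              rw [h]
              exact ⟨Or.inl rfl, haQ⟩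
          rw [this, Finset.card_singleton]; simp
        linarith
      have hnew : stage (insert Q parts') W' = stage parts' W' ∪ insert a Q := by
        ext z
        simp only [stage, Finset.biUnion_insert, id, Finset.mem_union, Finset.mem_insert]
        constructor
        · rintro ((h | h) | h)
          · exact Or.inr (Or.inr h)
          · exact Or.inl (Or.inl h)
          · exact Or.inl (Or.inr h)
        · rintro ((h | h) | h | h)
          · exact Or.inl (Or.inr h)
          · exact Or.inr h
          · rw [h]
            rcases Finset.mem_union.mp ha with h' | h'
            · exact Or.inl (Or.inr h')
            · exact Or.inr h'
          · exact Or.inl (Or.inl h)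
      have hU' := hU (stage parts' W') (insert a Q) hSne (Finset.insert_nonempty a Q) hconn hQa
        ⟨a, Finset.mem_inter.mpr ⟨ha, Finset.mem_insert_self a Q⟩⟩
      refine ⟨insert Q parts', W', Finset.insert_subset hQ hp, hW, Finset.insert_nonempty Q parts', ?_, ?_, ?_⟩
      · rw [hnew]
        exact faceConnected_union hconn hQa ⟨a, Finset.mem_inter.mpr ⟨ha, Finset.mem_insert_self a Q⟩⟩
      · right
        rw [Finset.card_insert_of_notMem hQnew]
        omega
      · rw [hnew, Finset.sum_insert hQnew, Finset.card_insert_of_notMem hQnew]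
        push_cast
        linarith
    · -- `b` is an extra cube, necessarily a new one: adjoin it
      have hbW : b ∈ D.W := D.mem_W.mpr ⟨hbZ, hbY⟩
      have hbnew : b ∉ W' := fun h => hb (Finset.mem_union.mpr (Or.inr h))
      have hnew : stage parts' (insert b W') = insert b (stage parts' W') := by
        simp [stage, Finset.union_insert]
      have hconn' : FaceConnected (insert b (stage parts' W')) := faceConnected_insert hconn ha hab
      have htb : tl (insert b (stage parts' W')) ≤ 1 + tl (stage parts' W') := by
        have h1 := hA (stage parts' W') (insert b (stage parts' W')) hSne (Finset.subset_insert _ _) hconn hconn'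
        have hc : ((insert b (stage parts' W') \ stage parts' W').card : ℝ) = 1 := by
          have : insert b (stage parts' W') \ stage parts' W' = {b} := by
            ext z
            simp only [Finset.mem_sdiff, Finset.mem_insert, Finset.mem_singleton]
            constructor
            · rintro ⟨h | h, h'⟩
              · exact h
              · exact absurd h h'
            · rintro h
              rw [h]
              exact ⟨Or.inl rfl, hb⟩
          rw [this, Finset.card_singleton]; simp
        linarith
      refine ⟨parts', insert b W', hp, Finset.insert_subset hbW hW, ⟨P₁, hP₁⟩, ?_, ?_, ?_⟩
      · rw [hnew]; exact hconn'
      · right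
        rw [Finset.card_insert_of_notMem hbnew]
        omega
      · rw [hnew, Finset.card_insert_of_notMem hbnew]
        push_cast
        linarith

/-- A stage equal to `Z₀` contains every component and every extra cube. [folklore] -/
theorem stage_eq_top {parts' : Finset (Finset (Pt d))} {W' : Finset (Pt d)} (hp : parts' ⊆ D.parts)
    (hW : W' ⊆ D.W) (h : stage parts' W' = D.Z₀) : parts' = D.parts ∧ W' = D.W := by
  constructor
  · refine Finset.Subset.antisymm hp ?_
    intro P hP
    obtain ⟨z, hz⟩ := D.ne P hP
    have hzS : z ∈ stage parts' W' := by rw [h]; exact D.sub P hP hz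
    rcases Finset.mem_union.mp hzS with hz' | hz'
    · obtain ⟨P', hP', hzP'⟩ := Finset.mem_biUnion.mp hz'
      exact D.part_eq hP (hp hP') hz hzP' ▸ hP'
    · exact absurd (D.mem_Y₀.mpr ⟨P, hP, hz⟩) (D.mem_W.mp (hW hz')).2
  · refine Finset.Subset.antisymm hW ?_
    intro w hw
    have hwS : w ∈ stage parts' W' := by rw [h]; exact D.W_subset hw
    rcases Finset.mem_union.mp hwS with hw' | hw'
    · obtain ⟨P', hP', hwP'⟩ := Finset.mem_biUnion.mp hw'
      exact absurd (D.mem_Y₀.mpr ⟨P', hp hP', hwP'⟩) (D.mem_W.mp hw).2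
    · exact hw'

/-- GROWTH, concluded: `d_k(Z₀) ≤ Σ_i d_k(Y_i) + M⁻⁴|Z₀∖Y₀| + (1 + cJ)·(n − 1)` (n = the number of components, n ≥ 1),
modulo `AdjoinLeaf` and `UnionLeaf`. [cite: Balaban1988RG2Cluster, (2.32) p.18] -/
theorem tl_le_sum_add (hne : D.parts.Nonempty) {cJ : ℝ} {tl : Finset (Pt d) → ℝ} (hA : AdjoinLeaf d tl)
    (hU : UnionLeaf d cJ tl) :
    tl D.Z₀ ≤ ∑ P ∈ D.parts, tl P + (D.W.card : ℝ) + (1 + cJ) * ((D.parts.card : ℝ) - 1) := by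
  obtain ⟨parts', W', hp, hW, -, -, hor, hbd⟩ := D.growth hne hA hU (D.parts.card + D.W.card + 1)
  have htop : stage parts' W' = D.Z₀ := by
    rcases hor with h | h
    · exact h
    · exfalso
      have h1 := Finset.card_le_card hp
      have h2 := Finset.card_le_card hW
      omega
  obtain ⟨rfl, rfl⟩ := D.stage_eq_top hp hW htop
  rw [htop] at hbd
  exact hbd

/-- COUNTING, the key fact: with at least two components, every component has a common wall with an extra cube
(a chain in `Z₀` from it to another component must leave it, and cannot enter another component directly since
distinct components have no common wall); the touching cube of the component is coded as a neighbour of the extra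
cube. [folklore] -/
theorem exists_W_adj (h2 : 1 < D.parts.card) {P : Finset (Pt d)} (hP : P ∈ D.parts) :
    ∃ q : Pt d × (Fin d × Bool), q.1 ∈ D.W ∧ nbr q.1 q.2 ∈ P := by
  obtain ⟨Q, hQ, hQP⟩ := Finset.exists_mem_ne h2 P
  obtain ⟨x, hx⟩ := D.ne P hP
  obtain ⟨y, hy⟩ := D.ne Q hQ
  have hyP : y ∉ P := fun h => Finset.disjoint_left.mp (D.disj Q hQ P hP hQP) hy h
  have hlink : Linked D.Z₀ x y := D.hZ x (D.sub P hP hx) y (D.sub Q hQ hy)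
  obtain ⟨a, b, ha, hb, hbZ, hab⟩ := exists_adj_exit hlink hx hyP
  have hbW : b ∈ D.W := by
    refine D.mem_W.mpr ⟨hbZ, ?_⟩
    intro hbY
    obtain ⟨Q', hQ', hbQ'⟩ := D.mem_Y₀.mp hbY
    have hne : P ≠ Q' := by
      rintro rfl
      exact hb hbQ'
    exact D.sep P hP Q' hQ' hne a ha b hbQ' hab
  obtain ⟨p, hp⟩ := exists_code_of_adj hab
  exact ⟨(b, p), hbW, hp ▸ ha⟩

/-- COUNTING: with at least two components, `n ≤ 2d·M⁻⁴|Z₀∖Y₀|` (the map component ↦ (touching extra cube, wall) is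
injective because components are disjoint; a cube has 2d walls). [folklore] -/
theorem card_parts_le_nat (h2 : 1 < D.parts.card) : D.parts.card ≤ D.W.card * (2 * d) := by
  classical
  obtain ⟨P₀, hP₀⟩ : D.parts.Nonempty := Finset.card_pos.mp (lt_trans zero_lt_one h2)
  obtain ⟨q₀, -⟩ := D.exists_W_adj h2 hP₀
  choose f hf using fun P (hP : P ∈ D.parts) => D.exists_W_adj h2 hP
  let g : Finset (Pt d) → Pt d × (Fin d × Bool) := fun P => if h : P ∈ D.parts then f P h else q₀
  have hg : ∀ P (hP : P ∈ D.parts), g P = f P hP := fun P hP => dif_pos hP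
  have hmaps : Set.MapsTo g ↑D.parts ↑(D.W ×ˢ (Finset.univ : Finset (Fin d × Bool))) := by
    intro P hP
    have hP' : P ∈ D.parts := hP
    rw [Finset.mem_coe, Finset.mem_product, hg P hP']
    exact ⟨(hf P hP').1, Finset.mem_univ _⟩
  have hinj : Set.InjOn g ↑D.parts := by
    intro P hP P' hP' hPP'
    have h1 := (hf P hP).2
    have h1' := (hf P' hP').2
    rw [← hg P hP] at h1
    rw [← hg P' hP', ← hPP'] at h1'
    exact D.part_eq hP hP' h1 h1'
  calc D.parts.card ≤ (D.W ×ˢ (Finset.univ : Finset (Fin d × Bool))).card :=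
        Finset.card_le_card_of_injOn g hmaps hinj
    _ = D.W.card * (2 * d) := by
        rw [Finset.card_product, Finset.card_univ, Fintype.card_prod, Fintype.card_fin, Fintype.card_bool]
        ring

/-- COUNTING in the form used: `n − 1 ≤ 2d·M⁻⁴|Z₀∖Y₀|` for any number `n` of components. [folklore] -/
theorem card_parts_le : ((D.parts.card : ℝ) - 1) ≤ 2 * d * (D.W.card : ℝ) := by
  by_cases h2 : 1 < D.parts.card
  · have h := D.card_parts_le_nat h2
    have h' : (D.parts.card : ℝ) ≤ (D.W.card : ℝ) * (2 * d) := by exact_mod_cast h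
    have hW : (0 : ℝ) ≤ D.W.card := Nat.cast_nonneg _
    nlinarith
  · have h' : (D.parts.card : ℝ) ≤ 1 := by exact_mod_cast (not_lt.mp h2)
    have hW : (0 : ℝ) ≤ D.W.card := Nat.cast_nonneg _
    have hd : (0 : ℝ) ≤ d := Nat.cast_nonneg _
    nlinarith

/-- THE SUBSTITUTE FOR (2.32), modulo the two published leaves:
`d_k(Z₀) ≤ Σ_i d_k(Y_i) + (1 + 2d(1 + cJ))·M⁻⁴|Z₀∖Y₀|` (n ≥ 1 components; cJ ≥ −1). [cite: Balaban1988RG2Cluster, (2.32) p.18] -/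
theorem ineq232_subst (hne : D.parts.Nonempty) {cJ : ℝ} (hcJ : -1 ≤ cJ) {tl : Finset (Pt d) → ℝ}
    (hA : AdjoinLeaf d tl) (hU : UnionLeaf d cJ tl) :
    tl D.Z₀ ≤ ∑ P ∈ D.parts, tl P + (1 + 2 * d * (1 + cJ)) * (D.W.card : ℝ) := by
  have h1 := D.tl_le_sum_add hne hA hU
  have h2 := D.card_parts_le
  have h3 : (1 + cJ) * ((D.parts.card : ℝ) - 1) ≤ (1 + cJ) * (2 * d * (D.W.card : ℝ)) :=
    mul_le_mul_of_nonneg_left h2 (by linarith)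
  linarith

/-- d = 4, sup-metric joining constant cJ = 1 (as printed in [Dimock2013]): `d_k(Z₀) ≤ Σ_i d_k(Y_i) + 17·M⁻⁴|Z₀∖Y₀|`
— so the b13 sub-cell's repaired constant 18 (cell GAPS.md G-B13-08, `B13.Consts.R16repaired`) suffices.
(Euclidean cJ = √4 = 2: constant 25; ℓ¹ cJ = 4: constant 41.) [cite: Balaban1988RG2Cluster, (2.32) p.18] -/
theorem ineq232_four_sup (D : CompData 4) (hne : D.parts.Nonempty) {tl : Finset (Pt 4) → ℝ}
    (hA : AdjoinLeaf 4 tl) (hU : UnionLeaf 4 1 tl) :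
    tl D.Z₀ ≤ ∑ P ∈ D.parts, tl P + 17 * (D.W.card : ℝ) := by
  have h := D.ineq232_subst hne (by norm_num) hA hU
  norm_num at h
  exact h

/-- d = 4, Euclidean joining constant cJ = 2: constant 25. [cite: Balaban1988RG2Cluster, (2.32) p.18] -/
theorem ineq232_four_eucl (D : CompData 4) (hne : D.parts.Nonempty) {tl : Finset (Pt 4) → ℝ}
    (hA : AdjoinLeaf 4 tl) (hU : UnionLeaf 4 2 tl) :
    tl D.Z₀ ≤ ∑ P ∈ D.parts, tl P + 25 * (D.W.card : ℝ) := by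
  have h := D.ineq232_subst hne (by norm_num) hA hU
  norm_num at h
  exact h

end CompData

/-! ## Part 4. The form in which (2.32) is consumed ((2.33), p. 19), and the repaired smallness clause -/

/-- Exponential form: from `t₀ ≤ s + c·N` and a rate `r ≥ 0`, `e^{−r s} ≤ e^{−r t₀}·e^{r c N}` — the factors
`exp(−(1−4δ)κ d_k(Y_i))` of (2.28) are traded for `exp(−(1−4δ)κ d_k(Z₀))` at the price `exp((1−4δ)κ·c·M⁻⁴|Z₀∖Y₀|)`
in (2.33) p. 19. [cite: Balaban1988RG2Cluster, (2.32)–(2.33) pp.18–19] -/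
theorem exp_form {t₀ s c N r : ℝ} (h : t₀ ≤ s + c * N) (hr : 0 ≤ r) :
    Real.exp (-(r * s)) ≤ Real.exp (-(r * t₀)) * Real.exp (r * c * N) := by
  rw [← Real.exp_add]
  apply Real.exp_le_exp.mpr
  have : r * t₀ ≤ r * (s + c * N) := mul_le_mul_of_nonneg_left h hr
  nlinarith

/-- Absorption: the price `e^{r c N}` is killed by one factor `exp(−(a/20)·N)`, a = γ₂ε₁²/g_k², split off the
|Z₀∖Y₀|-exponential of (2.33), as soon as `c·r ≤ a/20` — the printed clause (p. 18, last display) being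
*"(1/20)γ₂ε₁²/g_k² ≧ (1/20)γ₂ε₁²/γ² ≧ 4κ"* for the printed c = 4. [cite: Balaban1988RG2Cluster, p.18 (after (2.32))] -/
theorem absorb {r c N a : ℝ} (h : c * r ≤ a / 20) (hN : 0 ≤ N) :
    Real.exp (r * c * N) * Real.exp (-(a / 20 * N)) ≤ 1 := by
  rw [← Real.exp_add, ← Real.exp_zero]
  apply Real.exp_le_exp.mpr
  nlinarith

/-- (2.33) p. 19 [PDF 19], the case Y₀ ≠ ∅, verbatim: *"[Π_i ε₂ exp(−(1−4δ)κd_k(Y_i))] exp(−(1/10)γ₂(ε₁²/g_k²)M⁻⁴|Z₀∖Y₀|)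
≦ max{ε₂, exp(−(1/20)γ₂ε₁²/γ²)} exp(−(1−4δ)κd_k(Z₀)). (2.33) We have used the assumption ε₂ ≦ 1, and the fact that
if Y₀ is empty, then we have the exponential factor."* — CERTIFIED on the substitute for (2.32) with any constant `c`:
for n ≥ 1 components with tree lengths `dY i`, `d₀ = d_k(Z₀) ≤ Σ dY i + c·N` (N = M⁻⁴|Z₀∖Y₀| ≥ 0), `0 ≤ ε₂ ≤ 1`, rate
`r = (1−4δ)κ ≥ 0`, `a = γ₂ε₁²/g_k² ≥ 0` and the smallness `c·r ≤ a/20`: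
`Π_i (ε₂ e^{−r dY i}) · e^{−(a/10)N} ≤ ε₂ · e^{−r d₀}`.  Companion of the b13 sub-cell's `B13.case_empty_233` (Y₀ = ∅).
[cite: Balaban1988RG2Cluster, (2.33) p.19] -/
theorem case_nonempty_233 {ι : Type*} (s : Finset ι) (hs : s.Nonempty) (dY : ι → ℝ) {d₀ c N ε₂ r a : ℝ}
    (h232 : d₀ ≤ ∑ i ∈ s, dY i + c * N) (hε₀ : 0 ≤ ε₂) (hε₁ : ε₂ ≤ 1) (hr : 0 ≤ r) (ha : 0 ≤ a) (hN : 0 ≤ N)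
    (h16 : c * r ≤ a / 20) :
    (∏ i ∈ s, ε₂ * Real.exp (-(r * dY i))) * Real.exp (-(a / 10 * N)) ≤ ε₂ * Real.exp (-(r * d₀)) := by
  rw [Finset.prod_mul_distrib, Finset.prod_const, ← Real.exp_sum]
  have hpow : ε₂ ^ s.card ≤ ε₂ := pow_le_of_le_one hε₀ hε₁ (Finset.card_pos.mpr hs).ne'
  have hsum : ∑ i ∈ s, -(r * dY i) = -(r * ∑ i ∈ s, dY i) := by
    rw [Finset.mul_sum, ← Finset.sum_neg_distrib]
  rw [hsum]
  have hexp : Real.exp (-(r * ∑ i ∈ s, dY i)) * Real.exp (-(a / 10 * N)) ≤ Real.exp (-(r * d₀)) := by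
    rw [← Real.exp_add]
    apply Real.exp_le_exp.mpr
    have h1 : r * d₀ ≤ r * (∑ i ∈ s, dY i + c * N) := mul_le_mul_of_nonneg_left h232 hr
    have h2 : c * r * N ≤ a / 20 * N := mul_le_mul_of_nonneg_right h16 hN
    have h3 : 0 ≤ a * N := mul_nonneg ha hN
    nlinarith
  calc ε₂ ^ s.card * Real.exp (-(r * ∑ i ∈ s, dY i)) * Real.exp (-(a / 10 * N))
      = ε₂ ^ s.card * (Real.exp (-(r * ∑ i ∈ s, dY i)) * Real.exp (-(a / 10 * N))) := by ring
    _ ≤ ε₂ * Real.exp (-(r * d₀)) := mul_le_mul hpow hexp (by positivity) hε₀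

/-- The b13 sub-cell's repaired clause `R16repaired : 18κ ≤ (1/20)γ₂ε₁²/γ²` covers the kernel constant 17 at the rate
`(1 − 4δ)κ ≤ κ` of (2.28) (0 ≤ δ, 0 ≤ κ): `17·(1−4δ)κ ≤ (1/20)γ₂ε₁²/γ²`. [cite: Balaban1988RG2Cluster, p.18 (after (2.32))] -/
theorem seventeen_rate_le_of_R16repaired (c : B13.Consts) (hδ : 0 ≤ c.δ) (hκ : 0 ≤ c.κ) (h : c.R16repaired) :
    17 * ((1 - 4 * c.δ) * c.κ) ≤ c.γ₂ * c.ε₁ ^ 2 / c.γ ^ 2 / 20 := by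
  unfold B13.Consts.R16repaired at h
  nlinarith

/-! ## Part 5. "(2.32), properly adapted to the new situation" (p. 20) -/

/-- p. 20 [PDF 20], verbatim: *"|Σ_{𝐃,P,Z₀}(2.14)| ≦ exp(−(κ₁ − 1)(LM)⁻⁴|Z∖Z′₀|)·[Π_i 2(L + 2)⁴O(1)ε₂
exp(−(1 − 7δ)½Lκd_{k+1}(Z′_i))] exp O(1)α₅|Z|, (2.37) where now Z′_i denote connected components of Z′₀. The last
sum to estimate is the sum over Z′₀, or over Z∖Z′₀. Using the inequality (2.32), properly adapted to the new situation,
we bound the exponential factors in the square bracket above, and half of the first exponential factor, by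
exp(−(1 − 7δ)½Lκd_{k+1}(Z)). Of course, we assume that ½(κ₁ − 1) ≧ 2Lκ."*  Since the Z′_i ARE the connected components
of Z′₀ ⊂ Z (Z ∈ 𝐃_{k+1} connected) and Z∖Z′₀ consists of LM-cubes, the adapted (2.32) is (2.32) itself one scale up —
the datum `CompData` with π_{k+1}-cubes — so `CompData.ineq232_subst` IS the adapted inequality, with the same constant
c = 1 + 2d(1 + c_J).  CERTIFIED here: the exponential bookkeeping of the sentence, for any constant `c`, factor
`0 ≤ A ≤ 1` (A = 2(L + 2)⁴O(1)ε₂ ≤ 1 by p. 20's *"assuming that (L + 2)⁴O(1)ε₂ ≦ ½"*), rate `r ≥ 0`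
(r = (1 − 7δ)½Lκ printed; (1 − 7δ)ℓκ for a transfer factor ℓ), `b = κ₁ − 1`, N = (LM)⁻⁴|Z∖Z′₀|: if `d₀ ≤ Σ_i dZ i + c·N` and
`c·r ≤ b/2` then `e^{−bN}·Π_i (A e^{−r dZ i}) ≤ A·e^{−r d₀}·e^{−(b/2)N}` — all bracket factors and HALF of the first factor
become `e^{−r d_{k+1}(Z)}`, one factor A is left (Aⁿ ≤ A, n ≥ 1: *"We leave one factor 2(L + 2)⁴O(1)ε₂, and the remaining
factors are estimated by 1"*), the other half `e^{−(b/2)N}` remains for the sum over Z∖Z′₀. [cite: Balaban1988RG2Cluster, p.20 (after (2.37))] -/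
theorem adapted_p20 {ι : Type*} (s : Finset ι) (hs : s.Nonempty) (dZ : ι → ℝ) {d₀ c N A r b : ℝ}
    (h232 : d₀ ≤ ∑ i ∈ s, dZ i + c * N) (hA₀ : 0 ≤ A) (hA₁ : A ≤ 1) (hr : 0 ≤ r) (hN : 0 ≤ N)
    (hb : c * r ≤ b / 2) :
    Real.exp (-(b * N)) * ∏ i ∈ s, A * Real.exp (-(r * dZ i)) ≤
      A * Real.exp (-(r * d₀)) * Real.exp (-(b / 2 * N)) := by
  rw [Finset.prod_mul_distrib, Finset.prod_const, ← Real.exp_sum]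
  have hpow : A ^ s.card ≤ A := pow_le_of_le_one hA₀ hA₁ (Finset.card_pos.mpr hs).ne'
  have hsum : ∑ i ∈ s, -(r * dZ i) = -(r * ∑ i ∈ s, dZ i) := by
    rw [Finset.mul_sum, ← Finset.sum_neg_distrib]
  rw [hsum]
  have hexp : Real.exp (-(b * N)) * Real.exp (-(r * ∑ i ∈ s, dZ i)) ≤
      Real.exp (-(r * d₀)) * Real.exp (-(b / 2 * N)) := by
    rw [← Real.exp_add, ← Real.exp_add]
    apply Real.exp_le_exp.mpr
    have h1 : r * d₀ ≤ r * (∑ i ∈ s, dZ i + c * N) := mul_le_mul_of_nonneg_left h232 hr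
    have h2 : c * r * N ≤ b / 2 * N := mul_le_mul_of_nonneg_right hb hN
    nlinarith
  calc Real.exp (-(b * N)) * (A ^ s.card * Real.exp (-(r * ∑ i ∈ s, dZ i)))
      = A ^ s.card * (Real.exp (-(b * N)) * Real.exp (-(r * ∑ i ∈ s, dZ i))) := by ring
    _ ≤ A * (Real.exp (-(r * d₀)) * Real.exp (-(b / 2 * N))) := mul_le_mul hpow hexp (by positivity) hA₀
    _ = A * Real.exp (-(r * d₀)) * Real.exp (-(b / 2 * N)) := by ring

/-- p. 20 [PDF 20], verbatim: *"Of course, we assume that ½(κ₁ − 1) ≧ 2Lκ."* — the printed clause (cell census R20;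
not typed in `…B13`), on b13's constants record. [cite: Balaban1988RG2Cluster, p.20 (after (2.37))] -/
def R20 (c : B13.Consts) : Prop := 2 * (c.L : ℝ) * c.κ ≤ (c.κ₁ - 1) / 2

/-- The same clause for a geometric constant `cg` of (2.32) and a transfer factor `ℓ` of (2.36) (printed: cg = 4,
ℓ = ½L; the cell's readings carry cg = 17 [this module, sup metric] or 18 [G-B13-08], and ℓ = L/a(L) [G-B13-09R] or
L/10881 [`…B13ScaleTransfer`]): `cg·ℓ·κ ≤ ½(κ₁ − 1)`. [cite: Balaban1988RG2Cluster, p.20 (after (2.37))] -/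
def R20With (c : B13.Consts) (cg ℓ : ℝ) : Prop := cg * ℓ * c.κ ≤ (c.κ₁ - 1) / 2

/-- The printed clause is `R20With` with cg = 4, ℓ = ½L. [cite: Balaban1988RG2Cluster, p.20 (after (2.37))] -/
theorem R20With_printed_iff (c : B13.Consts) : R20With c 4 ((c.L : ℝ) / 2) ↔ R20 c := by
  unfold R20With R20
  constructor <;> intro h <;> linarith

/-- With the kernel constant 17 and the printed transfer factor ½L the clause reads `17Lκ ≤ κ₁ − 1`
(printed: 4Lκ ≤ κ₁ − 1; G-B13-08's hand repair: 18Lκ ≤ κ₁ − 1). [cite: Balaban1988RG2Cluster, p.20 (after (2.37))] -/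
theorem R20With_seventeen_iff (c : B13.Consts) : R20With c 17 ((c.L : ℝ) / 2) ↔ 17 * (c.L : ℝ) * c.κ ≤ c.κ₁ - 1 := by
  unfold R20With
  constructor <;> intro h <;> linarith

/-- `R20With cg ℓ` delivers the hypothesis `c·r ≤ b/2` of `adapted_p20` at the p. 20 rate r = (1 − 7δ)ℓκ, b = κ₁ − 1
(δ, κ, ℓ, cg ≥ 0). [cite: Balaban1988RG2Cluster, p.20 (after (2.37))] -/
theorem rate_p20_of_R20With (c : B13.Consts) {cg ℓ : ℝ} (hcg : 0 ≤ cg) (hℓ : 0 ≤ ℓ) (hδ : 0 ≤ c.δ) (hκ : 0 ≤ c.κ)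
    (h : R20With c cg ℓ) : cg * ((1 - 7 * c.δ) * ℓ * c.κ) ≤ (c.κ₁ - 1) / 2 := by
  unfold R20With at h
  have h1 : 0 ≤ cg * ℓ * c.κ := mul_nonneg (mul_nonneg hcg hℓ) hκ
  have h2 : 0 ≤ c.δ * (cg * ℓ * c.κ) := mul_nonneg hδ h1
  nlinarith

end Literature.MathematicalPhysics.QuantumFieldTheory.Balaban1983to89.B13Ineq232

end
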